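import Summits.HodgeConjecture.HodgeConjecture.Theses.DworkReflectionQuotients
import Literature.AlgebraicGeometry.HodgeTheory.DworkSexticTopCharacter

/-!
# Item `TopCharacterTrivial` (child 1 of crux K2, route `DworkReflectionQuotients`): PROVED

Route `route-HodgeConjecture-DworkReflectionQuotients` (cell `hodge-nonav`, rung F-H1 — never summit
credit), item `stmt-HodgeConjecture-21151` `TopCharacterTrivial` (child 1 of the split of crux K2
`FlatClassesSpannedByReflectionInvariants`, stmt-HodgeConjecture-20241): for `ψ⁶ ≠ 1` every
`Γ_W`-eigenclass of `H⁴(X_ψ(ℂ); ℂ)` of NON-trivial character whose pull-back to a Hodge model is of type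
`(4,0)` vanishes. Prover seat `hodge-nonav-20241-p1` (g4), 2026-08-27; `--workitem stmt-HodgeConjecture-21151`.

The proof is the tree theorem `DworkSextic.topCharacter_trivial` (`Literature/…/DworkSexticTopCharacter`),
the Dwork instance of `hypersurface_eigenspace_hodgePQ_top_zero_eq_zero_of_ne_prod`
(`CalabiYauHypersurfaceTopFormCharacter`): on the compact connected analytification of the Calabi–Yau
sextic `X_ψ`, Griffiths' residue `Res(Ω/F_ψ)` is a nowhere-vanishing holomorphic `4`-form transforming
by `det = ∏ aᵢ` under the diagonal symmetries (`CanonicalDegreeHypersurfaceResidueForm`), every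
holomorphic `4`-form is its constant multiple (`Geometry/Kaehler/HolomorphicTopFormsLine`, Liouville),
`(4,0)`-classes are classes of holomorphic `4`-forms (`HolomorphicTopFormClassesBijective`) and
eigenclasses give eigenforms (`eigenspace_hodgePQ_top_zero_eq_zero_of_eigenforms`); on `Γ_W`, `∏ aᵢ = 1`.
UNCONDITIONAL (no named fact).

## References

* N. M. Katz, *Another look at the Dwork family*, Progr. Math. 270 (2009), §3, Lemma 3.1. [Katz2009]
* C. Voisin, *Hodge Theory and Complex Algebraic Geometry II* (2003), §6.1.3, Cor. 6.12. [VoisinHodgeII2003]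
-/

namespace Summit.HodgeConjecture.HodgeConjecture.Theorems

open Literature.AlgebraicGeometry.HodgeTheory

/-- **`TopCharacterTrivial` holds**: for `ψ⁶ ≠ 1`, every Hodge model `A` of `X_ψ`, every character
`θ ≠ 1` of `Γ_W` and every `x` in the `θ`-eigenspace of `H⁴(X_ψ(ℂ); ℂ)` with `A^* x ∈ H^{4,0}_A`, `x = 0`
— `H^{4,0}(X_ψ) = ℂ · Res(Ω/F_ψ)` carries the trivial character of `Γ_W` (`∏ aᵢ = 1`). By the tree
theorem `DworkSextic.topCharacter_trivial`. Relies on nothing unproved.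
[cite: Katz2009, §3 and Lemma 3.1] [cite: VoisinHodgeII2003, §6.1.3 Cor. 6.12 (p = 1)] -/
theorem topCharacterTrivial_proof :
    Summit.HodgeConjecture.HodgeConjecture.Theses.DworkReflectionQuotients.TopCharacterTrivial :=
  fun _ hψ => DworkSextic.topCharacter_trivial hψ

end Summit.HodgeConjecture.HodgeConjecture.Theorems
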